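import Summits.QuantumAdvantage.AdviceFreeQNC0.WalkFailFloor
import Summits.QuantumAdvantage.AdviceFreeQNC0.WalkTransport
import HarnessLib

/-!
# Route RingFrame, crux α `RingToElim` (stmt-QuantumAdvantage-19119): the FAIL FLOOR and the EXACT
# LAW read on the ring — every polynomial device of degree `D` for the `(n+1)`-cycle errs on at
# least `2^{n−2D−3}` measurement patterns (all `n ≥ 2D+3`, all `D ≥ 1`)

Support theorem for the crux item α in the language of the rung leaf `RingHard 2`
(`Literature…RingHLF.Rel`), transported from the cell's fail floor of the walk game
(`ringWinU_fail_floor`, `WalkFailFloor.lean`, over the full exact law `fullSpan_not_perfect` of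
`WalkExactLaw.lean`) through the affine chart of `WalkTransport.lean` (`rel_iff_ringWinU`,
`xOfU_uVec`, `hasDeg_transport`):

* `ringRel_fail_floor` — for `D ≥ 1`, `n ≥ 2D+3` and every tuple `P` of `𝔽₂`-polynomials on
  `{0,1}^{n+1}` of degree `≤ D`, the relation `Rel x (P x)` FAILS for at least `2^{n−(2D+3)}`
  measurement patterns `x` (of the `2^{n+1}`);
* `ringExactLowerBound_all` — hence no EXACT polynomial resolvent of degree `≤ (N−4)/2` exists on
  the `N`-cycle, `N ≥ 6`: the all-`N` form (even `N` sharp, odd `N` one below the phase law of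
  TARGET §15.3) of the first rung `RingExactLowerBound` of the ring route, previously certified
  only for `N ≤ 12` (`ringExactLowerBound_five … _twelve`, dual certificates by `native_decide`).

Proof of the floor: the transported walk strategy `y_g(u) = [P_g(xOfU u) = 1] ⊕ t(xOfU u)_g` has
degree `≤ D` and wins at `uVec x` iff `Rel x (P x)` for `x` in the odd class; `uVec` is injective on
the odd class (`xOfU_uVec`), the even class has `≤ 2ⁿ` patterns (`card_even_class_le`), so `uVec`
maps the odd class ONTO the walk cube and every failing `u` lifts to a failing odd-class `x`.
The cell's statement (prover qn-prover-3 gen 5; a special case / instrument for crux α of route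
RingFrame); not in print.  WHAT THIS IS NOT: not a constant-loss bound (`RingHard 2` / α); the
exponent is `2D+3`; no separation claim.
-/

-- the sub-problem namespace `Summit.QuantumAdvantage.QuantumAdvantage` repeats the summit name by design (D-0017)
set_option linter.dupNamespace false

noncomputable section

namespace Summit.QuantumAdvantage.QuantumAdvantage.Theorems

open Finset Summit.QuantumAdvantage.AdviceFreeQNC0
open Literature.Computability.QuantumComplexity Literature.Computability.QuantumComplexity.RingHLF
open Literature.Computability.MetaComplexity Literature.Computability.MetaComplexity.Smolensky

/-- **THE FAIL FLOOR ON THE RING.**  For `D ≥ 1`, `n ≥ 2D+3` and every tuple `P` of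
`𝔽₂`-polynomials of degree `≤ D` on the patterns of the `(n+1)`-cycle, `Rel x (P x)` fails for at
least `2^{n−(2D+3)}` patterns `x`. [folklore] -/
theorem ringRel_fail_floor (D : ℕ) (hD : 1 ≤ D) {n : ℕ} (hn : 2 * D + 3 ≤ n)
    (P : Fin (n + 1) → CubeFn (ZMod 2) (n + 1)) (hP : ∀ i, P i ∈ lowDeg (ZMod 2) (n + 1) D) :
    2 ^ (n - (2 * D + 3)) ≤
      (univ.filter fun x : Fin (n + 1) → Bool => ¬ Rel x (fun i => decide (P i x = 1))).card := by
  classical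
  have hn2 : 2 ≤ n := by omega
  -- the transported walk strategy and its degree
  set z : (Fin (n + 1) → Bool) → (Fin (n + 1) → Bool) := fun x i => decide (P i x = 1) with hz
  set y : Fin (n + 1) → (Fin n → Bool) → Bool :=
    fun g u => xor (z (xOfU u) g) (tGuess (xOfU u) g) with hy
  have hdeg : ∀ g, HasDeg (y g) D := fun g => hasDeg_transport hD (P g) (hP g) g
  have hfloor := ringWinU_fail_floor D hn (n + 2) y hdeg
  -- the odd class maps ONTO the walk cube under `uVec`
  set Odd : Finset (Fin (n + 1) → Bool) := univ.filter fun x : Fin (n + 1) → Bool =>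
    (univ.filter fun j : Fin (n + 1) => x j = false).card % 2 = 1 with hOdd
  have hinj : Set.InjOn uVec (Odd : Set (Fin (n + 1) → Bool)) := by
    intro x₁ hx₁ x₂ hx₂ h
    rw [Finset.mem_coe, hOdd, mem_filter] at hx₁ hx₂
    rw [← xOfU_uVec hn2 x₁ hx₁.2, ← xOfU_uVec hn2 x₂ hx₂.2, h]
  have hOddcard : 2 ^ n ≤ Odd.card := by
    have htot : Odd.card + (univ.filter fun x : Fin (n + 1) → Bool =>
        ¬ (univ.filter fun j : Fin (n + 1) => x j = false).card % 2 = 1).card = 2 ^ (n + 1) := by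
      rw [hOdd, Finset.card_filter_add_card_filter_not, Finset.card_univ, Fintype.card_fun,
        Fintype.card_bool, Fintype.card_fin]
    have heven := (card_even_class_le (n := n))
    have h2 : 2 ^ (n + 1) = 2 ^ n + 2 ^ n := by ring
    omega
  have himage : Odd.image uVec = univ := by
    apply Finset.eq_univ_of_card
    rw [Finset.card_image_of_injOn hinj, Fintype.card_fun, Fintype.card_bool, Fintype.card_fin]
    refine le_antisymm ?_ hOddcard
    calc Odd.card = (Odd.image uVec).card := (Finset.card_image_of_injOn hinj).symm
      _ ≤ (univ : Finset (Fin n → Bool)).card := Finset.card_le_univ _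
      _ = 2 ^ n := by rw [Finset.card_univ, Fintype.card_fun, Fintype.card_bool, Fintype.card_fin]
  -- every failing `u` lifts to a failing odd-class pattern
  have hsub : (univ.filter fun u : Fin n → Bool => ringWinU (n + 2) y u = false) ⊆
      (Odd.filter fun x => ¬ Rel x (z x)).image uVec := by
    intro u hu
    have hu' := (Finset.mem_filter.1 hu).2
    have hmem : u ∈ Odd.image uVec := by rw [himage]; exact Finset.mem_univ _
    obtain ⟨x, hx, rfl⟩ := Finset.mem_image.1 hmem
    refine Finset.mem_image.2 ⟨x, Finset.mem_filter.2 ⟨hx, fun hrel => ?_⟩, rfl⟩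
    have hodd := (Finset.mem_filter.1 hx).2
    have hwin := (rel_iff_ringWinU hn2 x hodd z).1 hrel
    rw [hwin] at hu'
    exact Bool.noConfusion hu'
  calc 2 ^ (n - (2 * D + 3))
      ≤ (univ.filter fun u : Fin n → Bool => ringWinU (n + 2) y u = false).card := hfloor
    _ ≤ ((Odd.filter fun x => ¬ Rel x (z x)).image uVec).card := Finset.card_le_card hsub
    _ ≤ (Odd.filter fun x => ¬ Rel x (z x)).card := Finset.card_image_le
    _ ≤ (univ.filter fun x : Fin (n + 1) → Bool => ¬ Rel x (z x)).card := by
        refine Finset.card_le_card fun x hx => ?_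
        rw [Finset.mem_filter] at hx ⊢
        exact ⟨Finset.mem_univ _, hx.2⟩

/-- **No exact low-degree resolvent on any ring** (the all-`N` form of `RingExactLowerBound`,
previously certified for `N ≤ 12`): for `N ≥ 6`, a map `F` with `Rel x (F x)` for EVERY pattern
`x ∈ {0,1}^N` has some output bit of `𝔽₂`-degree `> (N − 4)/2`. [folklore] -/
theorem ringExactLowerBound_all {N : ℕ} (hN : 6 ≤ N) (F : (Fin N → Bool) → (Fin N → Bool))
    (hF : ∀ x, Rel x (F x)) :
    ∃ k : Fin N, (fun x => if F x k then (1 : ZMod 2) else 0) ∉ lowDeg (ZMod 2) N ((N - 4) / 2) := by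
  classical
  obtain ⟨n, rfl⟩ : ∃ n, N = n + 1 := ⟨N - 1, by omega⟩
  by_contra hall
  simp only [not_exists, not_not] at hall
  set D := (n + 1 - 4) / 2 with hDdef
  have hD : 1 ≤ D := by omega
  have hn : 2 * D + 3 ≤ n := by omega
  have h := ringRel_fail_floor D hD hn (fun k x => if F x k then (1 : ZMod 2) else 0) hall
  have hz : ∀ x : Fin (n + 1) → Bool,
      (fun i => decide ((if F x i then (1 : ZMod 2) else 0) = 1)) = F x := by
    intro x; funext i; cases F x i <;> simp
  have hempty : (univ.filter fun x : Fin (n + 1) → Bool =>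
      ¬ Rel x (fun i => decide ((if F x i then (1 : ZMod 2) else 0) = 1))) = ∅ := by
    refine Finset.filter_false_of_mem fun x _ => ?_
    rw [hz x, not_not]
    exact hF x
  rw [hempty, Finset.card_empty] at h
  have hpos : 0 < 2 ^ (n - (2 * D + 3)) := Nat.two_pow_pos _
  omega

end Summit.QuantumAdvantage.QuantumAdvantage.Theorems

end
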